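import Mathlib
import HarnessLib
import Summits.HubbardSuperconductivity.HubbardSuperconductivity.Theorems.KLProgrammeKLRegimeVolumeLimitCutoffDoor
import Summits.HubbardSuperconductivity.HubbardSuperconductivity.Theorems.KLProgrammeKLRegimeVolumeLimitSecondOrderRateSymbols

/-!
# Child `KLRegimeVolumeLimitV12` (stmt-HubbardSuperconductivity-19858) — the cutoff-free two-volume rate IN ANY ADMISSIBLE FRAME from the
# BARE, SPIN-FREE pieces: the density `occ∞(L)` and the six-point Matsubara coefficient `Six∞_L(n,p)` (seat hubbard-kl-k3c5-p3 g4,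
# technique «OS-positivity-free direct assembly»)

`…VolumeLimitCutoffDoor` reduced the registered Cauchy stub `stub_vl_twoVolumeRate` to a two-volume rate of the cutoff-free carrier
`Σ∞^K_L(n,p) = klSelfEnergyInf L β U μ K n p`.  The frame enters `Σ∞^K` only through the EXPLICIT dressing symbol `d(n,q) = g₀/g_K = 1 − K(q)·g₀(n,q)`
(`propInt_div_eq_dress`; k3c4-p1's `klso_dress_*`: `2πℤ²`-periodic, `‖d‖ ≤ 1 + ‖K‖₀β/π`, sup-Lipschitz under `FrameOK`):
`Σ∞^K = d²·Σ∞⁰ + K·d`, `Σ∞⁰ = U·occ∞ + U²·Six∞` (`klSelfEnergyInf_eq_bare_dressed`).  Hence (`cutoffFreeRate_of_bareRates`): a thermodynamic-limit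
RATE OF THE DENSITY `‖occ∞(L) − occ∞(L′)‖ ≤ ρ₁ L`, a two-volume rate with momentum modulus of `Six∞_L(n,p)` and an `L`-uniform bound on it give
the two-volume rate of `Σ∞^K_L` for every admissible frame (torus-Lipschitz moduli by k3c4-p1's `norm_sub_le_mul_tmod_of_periodic`), and
**`stub_vl_twoVolumeRate_of_bareRates`**: the registered Cauchy stub VERBATIM from the same text with its conclusion replaced by these three
BARE, SPIN-FREE, CUTOFF-FREE statements.  Everything is proved; no definition.
-/

noncomputable section

namespace Summit.HubbardSuperconductivity.HubbardSuperconductivity.Theorems.TwoPointAssembly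

set_option linter.dupNamespace false -- summit = problem name (single-conjunct summit), D-0017

open Finset Filter Topology Literature.MathematicalPhysics.QuantumLattice Literature.Probability.LatticeModels GrassmannAlgebra
open Literature.MathematicalPhysics.QuantumLattice.FermiRG
open Summit.HubbardSuperconductivity.HubbardSuperconductivity.Theorems.DispersionFlow
open Summit.HubbardSuperconductivity.HubbardSuperconductivity.Theorems.KLRegimeSplit
open Summit.HubbardSuperconductivity.HubbardSuperconductivity.Theorems.KLProgrammeLegKernels

/-! ## §1 Dictionary: the `propInt` dressing IS k3c4-p1's dressing symbol -/

/-- `g₀(n,q)/g_K(n,q) = 1 − K(q)·(ξ(q) − iω_n)⁻¹` (`β ≠ 0`): the cutoff-free frame dressing of `klSelfEnergyInf` is the dressing symbol of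
`…VolumeLimitSecondOrderRateSymbols`. -/
theorem propInt_div_eq_dress {β : ℝ} (hβ : β ≠ 0) (μ : ℝ) (K : TrigPolyC4v) (n : ℤ) (q : Fin 2 → ℝ) :
    propInt β μ 0 n q / propInt β μ K n q =
      1 - (K.eval q : ℂ) * ((bandCT μ 0 q : ℂ) - Complex.I * (fermiMatsubara β n : ℂ))⁻¹ := by
  have hD0 := propInt_den_ne_zero hβ μ 0 n q
  have hDK := propInt_den_ne_zero hβ μ K n q
  set dK : ℂ := -Complex.I * (freqOfInt β n : ℂ) + (bandCT μ K q : ℂ) with hdK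
  set d0 : ℂ := -Complex.I * (freqOfInt β n : ℂ) + (bandCT μ 0 q : ℂ) with hd0
  have hrel : dK = d0 - (K.eval q : ℂ) := by
    rw [hd0, hdK]; simp only [bandCT, TrigPolyC4v.eval_zero]; push_cast; ring
  have hbare : ((bandCT μ 0 q : ℂ) - Complex.I * (fermiMatsubara β n : ℂ)) = d0 := by
    rw [hd0, show fermiMatsubara β n = freqOfInt β n from rfl]; ring
  have h1 : propInt β μ K n q = 1 / dK := rfl
  have h2 : propInt β μ 0 n q = 1 / d0 := rfl
  rw [h1, h2, hbare, hrel]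
  field_simp

/-- **`Σ∞^K = d²·(U·occ∞ + U²·Six∞) + K·d`** with `d = d(n, p_k)` the dressing symbol at the grid momentum (`β ≠ 0`). -/
theorem klSelfEnergyInf_eq_bare_dressed {L : ℕ} [NeZero L] {β : ℝ} (hβ : β ≠ 0) (U μ : ℝ) (K : TrigPolyC4v) (n : ℤ) (k : TorusSite 2 L) :
    klSelfEnergyInf L β U μ K n k =
      (1 - (K.eval (latticeMomentum L k) : ℂ) *
            ((bandCT μ 0 (latticeMomentum L k) : ℂ) - Complex.I * (fermiMatsubara β n : ℂ))⁻¹) ^ 2 *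
          ((U : ℂ) * klOccInf L β U μ + (U : ℂ) ^ 2 * klSixInf L β U μ n k) +
        (K.eval (latticeMomentum L k) : ℂ) *
          (1 - (K.eval (latticeMomentum L k) : ℂ) * ((bandCT μ 0 (latticeMomentum L k) : ℂ) - Complex.I * (fermiMatsubara β n : ℂ))⁻¹) := by
  rw [klSelfEnergyInf_eq_dressing hβ, klSelfEnergyInf_zero_frame hβ, propInt_sub_div_sq_eq hβ, propInt_div_eq_dress hβ]

/-! ## §2 Torus-Lipschitz moduli of the dressing symbols under `FrameOK` -/

section Frame

variable {R : RenConsts} {U₁ : ℝ} {N : ℕ} {μ : ℝ} {K : TrigPolyC4v}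

/-- The squared dressing symbol is torus-Lipschitz: `‖d(n,x)² − d(n,y)²‖ ≤ L₂·Σ_i |x_i − y_i|_𝕋` (`FrameOK`, `β > 0`). -/
theorem dressSq_sub_le_tmod {β : ℝ} (hβ : 0 < β) (hK : FrameOK R U₁ N μ K) (n : ℤ) (x y : Fin 2 → ℝ) :
    ‖((1 : ℂ) - (K.eval x : ℂ) * ((bandCT μ 0 x : ℂ) - Complex.I * (fermiMatsubara β n : ℂ))⁻¹) ^ 2 -
        ((1 : ℂ) - (K.eval y : ℂ) * ((bandCT μ 0 y : ℂ) - Complex.I * (fermiMatsubara β n : ℂ))⁻¹) ^ 2‖ ≤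
      2 * (1 + K.coeffNorm 0 * (β / Real.pi)) * ((4 + 7 * Real.sqrt 2) * (β / Real.pi) + K.coeffNorm 0 * (4 * β ^ 2 / Real.pi ^ 2)) *
        ∑ i, torusAbs (x i - y i) := by
  have hK0 := TrigPolyC4v.coeffNorm_nonneg 0 K
  exact norm_sub_le_mul_tmod_of_periodic
    (f := fun q : Fin 2 → ℝ => ((1 : ℂ) - (K.eval q : ℂ) * ((bandCT μ 0 q : ℂ) - Complex.I * (fermiMatsubara β n : ℂ))⁻¹) ^ 2)
    (by positivity) (fun p m => klso_dressSq_periodic β μ K n p m) (fun p q => klso_dressSq_sub_le hβ hK n p q) x y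

/-- The additive frame term `K(q)·d(n,q)` is bounded by `‖K‖₀·(1 + ‖K‖₀β/π)`. -/
theorem norm_eval_mul_dress_le {β : ℝ} (hβ : 0 < β) (μ : ℝ) (K : TrigPolyC4v) (n : ℤ) (q : Fin 2 → ℝ) :
    ‖(K.eval q : ℂ) * ((1 : ℂ) - (K.eval q : ℂ) * ((bandCT μ 0 q : ℂ) - Complex.I * (fermiMatsubara β n : ℂ))⁻¹)‖ ≤
      K.coeffNorm 0 * (1 + K.coeffNorm 0 * (β / Real.pi)) := by
  rw [norm_mul, Complex.norm_real, Real.norm_eq_abs]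
  exact mul_le_mul (TrigPolyC4v.abs_eval_le_coeffNorm K q) (klso_dress_norm_le hβ μ K n q) (norm_nonneg _)
    (TrigPolyC4v.coeffNorm_nonneg 0 K)

/-- The additive frame term is sup-Lipschitz under `FrameOK`. -/
theorem eval_mul_dress_sub_le {β : ℝ} (hβ : 0 < β) (hK : FrameOK R U₁ N μ K) (n : ℤ) (x y : Fin 2 → ℝ) :
    ‖(K.eval x : ℂ) * ((1 : ℂ) - (K.eval x : ℂ) * ((bandCT μ 0 x : ℂ) - Complex.I * (fermiMatsubara β n : ℂ))⁻¹) -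
        (K.eval y : ℂ) * ((1 : ℂ) - (K.eval y : ℂ) * ((bandCT μ 0 y : ℂ) - Complex.I * (fermiMatsubara β n : ℂ))⁻¹)‖ ≤
      ((4 + 7 * Real.sqrt 2) * (1 + K.coeffNorm 0 * (β / Real.pi)) +
          K.coeffNorm 0 * ((4 + 7 * Real.sqrt 2) * (β / Real.pi) + K.coeffNorm 0 * (4 * β ^ 2 / Real.pi ^ 2))) * ‖x - y‖ := by
  set dx : ℂ := (1 : ℂ) - (K.eval x : ℂ) * ((bandCT μ 0 x : ℂ) - Complex.I * (fermiMatsubara β n : ℂ))⁻¹ with hdx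
  set dy : ℂ := (1 : ℂ) - (K.eval y : ℂ) * ((bandCT μ 0 y : ℂ) - Complex.I * (fermiMatsubara β n : ℂ))⁻¹ with hdy
  have hdxn : ‖dx‖ ≤ 1 + K.coeffNorm 0 * (β / Real.pi) := klso_dress_norm_le hβ μ K n x
  have hdxy : ‖dx - dy‖ ≤ ((4 + 7 * Real.sqrt 2) * (β / Real.pi) + K.coeffNorm 0 * (4 * β ^ 2 / Real.pi ^ 2)) * ‖x - y‖ :=
    klso_dress_sub_le hβ hK n x y
  have hKxy := klso_abs_eval_sub_le hK x y
  have hKy := TrigPolyC4v.abs_eval_le_coeffNorm K y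
  have hK0 := TrigPolyC4v.coeffNorm_nonneg 0 K
  have hsplit : (K.eval x : ℂ) * dx - (K.eval y : ℂ) * dy = ((K.eval x : ℂ) - (K.eval y : ℂ)) * dx + (K.eval y : ℂ) * (dx - dy) := by ring
  rw [hsplit]
  calc ‖((K.eval x : ℂ) - (K.eval y : ℂ)) * dx + (K.eval y : ℂ) * (dx - dy)‖
      ≤ ‖((K.eval x : ℂ) - (K.eval y : ℂ)) * dx‖ + ‖(K.eval y : ℂ) * (dx - dy)‖ := norm_add_le _ _
    _ = |K.eval x - K.eval y| * ‖dx‖ + |K.eval y| * ‖dx - dy‖ := by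
        rw [norm_mul, norm_mul, ← Complex.ofReal_sub, Complex.norm_real, Complex.norm_real, Real.norm_eq_abs, Real.norm_eq_abs]
    _ ≤ (4 + 7 * Real.sqrt 2) * ‖x - y‖ * (1 + K.coeffNorm 0 * (β / Real.pi)) +
          K.coeffNorm 0 * (((4 + 7 * Real.sqrt 2) * (β / Real.pi) + K.coeffNorm 0 * (4 * β ^ 2 / Real.pi ^ 2)) * ‖x - y‖) :=
        add_le_add (mul_le_mul hKxy hdxn (norm_nonneg _) (by positivity)) (mul_le_mul hKy hdxy (norm_nonneg _) hK0)
    _ = _ := by ring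

/-- The additive frame term is torus-Lipschitz under `FrameOK`. -/
theorem eval_mul_dress_sub_le_tmod {β : ℝ} (hβ : 0 < β) (hK : FrameOK R U₁ N μ K) (n : ℤ) (x y : Fin 2 → ℝ) :
    ‖(K.eval x : ℂ) * ((1 : ℂ) - (K.eval x : ℂ) * ((bandCT μ 0 x : ℂ) - Complex.I * (fermiMatsubara β n : ℂ))⁻¹) -
        (K.eval y : ℂ) * ((1 : ℂ) - (K.eval y : ℂ) * ((bandCT μ 0 y : ℂ) - Complex.I * (fermiMatsubara β n : ℂ))⁻¹)‖ ≤
      ((4 + 7 * Real.sqrt 2) * (1 + K.coeffNorm 0 * (β / Real.pi)) +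
          K.coeffNorm 0 * ((4 + 7 * Real.sqrt 2) * (β / Real.pi) + K.coeffNorm 0 * (4 * β ^ 2 / Real.pi ^ 2))) *
        ∑ i, torusAbs (x i - y i) := by
  have hK0 := TrigPolyC4v.coeffNorm_nonneg 0 K
  refine norm_sub_le_mul_tmod_of_periodic
    (f := fun q : Fin 2 → ℝ => (K.eval q : ℂ) * ((1 : ℂ) - (K.eval q : ℂ) * ((bandCT μ 0 q : ℂ) - Complex.I * (fermiMatsubara β n : ℂ))⁻¹))
    (by positivity) (fun p m => ?_) (fun p q => eval_mul_dress_sub_le hβ hK n p q) x y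
  rw [klso_dress_periodic, TrigPolyC4v.eval_periodic]

end Frame

/-! ## §3 The cutoff-free rate in the frame from the bare pieces -/

/-- **THE CUTOFF-FREE TWO-VOLUME RATE IN AN ADMISSIBLE FRAME FROM THE BARE, SPIN-FREE PIECES** (`β > 0`, `FrameOK R U₁ N μ K`, any real
`U`).  A thermodynamic-limit rate of the density, `‖occ∞(L) − occ∞(L′)‖ ≤ ρ₁ L` (`ρ₁ → 0`), a two-volume rate with momentum modulus of the
six-point coefficient, `‖Six∞_L(n,k) − Six∞_{L′}(n,k′)‖ ≤ ρ₂ L + D₂·Σ_i |p_k i − p′_{k′} i|_𝕋` (`ρ₂ → 0`), and an `L`-uniform bound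
`‖Six∞_L(n,k)‖ ≤ B`, all beyond `L₀`, give a two-volume rate of `klSelfEnergyInf L β U μ K` beyond `L₀`. -/
theorem cutoffFreeRate_of_bareRates {β : ℝ} (hβ : 0 < β) {R : RenConsts} {U₁ : ℝ} {N : ℕ} {μ : ℝ} {K : TrigPolyC4v}
    (hK : FrameOK R U₁ N μ K) (U : ℝ) {L₀ : ℕ} {D₂ B : ℝ} {ρ₁ ρ₂ : ℕ → ℝ}
    (hρ₁ : Tendsto ρ₁ atTop (𝓝 0)) (hρ₂ : Tendsto ρ₂ atTop (𝓝 0))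
    (hocc : ∀ (L : ℕ) [NeZero L], L₀ ≤ L → ∀ (L' : ℕ) [NeZero L'], L ≤ L' → ‖klOccInf L β U μ - klOccInf L' β U μ‖ ≤ ρ₁ L)
    (hsix : ∀ (L : ℕ) [NeZero L], L₀ ≤ L → ∀ (L' : ℕ) [NeZero L'], L ≤ L' →
      ∀ (n : ℤ) (k : TorusSite 2 L) (k' : TorusSite 2 L'),
        ‖klSixInf L β U μ n k - klSixInf L' β U μ n k'‖ ≤ ρ₂ L + D₂ * ∑ i, torusAbs (latticeMomentum L k i - latticeMomentum L' k' i))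
    (hsixB : ∀ (L : ℕ) [NeZero L], L₀ ≤ L → ∀ (n : ℤ) (k : TorusSite 2 L), ‖klSixInf L β U μ n k‖ ≤ B) :
    ∃ D : ℝ, ∃ ρ : ℕ → ℝ, Tendsto ρ atTop (𝓝 0) ∧
      ∀ (L : ℕ) [NeZero L], L₀ ≤ L → ∀ (L' : ℕ) [NeZero L'], L ≤ L' →
        ∀ (n : ℤ) (k : TorusSite 2 L) (k' : TorusSite 2 L'),
          ‖klSelfEnergyInf L β U μ K n k - klSelfEnergyInf L' β U μ K n k'‖ ≤
            ρ L + D * ∑ i, torusAbs (latticeMomentum L k i - latticeMomentum L' k' i) := by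
  have hK0 := TrigPolyC4v.coeffNorm_nonneg 0 K
  -- constants
  set Bd : ℝ := 1 + K.coeffNorm 0 * (β / Real.pi) with hBd
  set Ld : ℝ := (4 + 7 * Real.sqrt 2) * (β / Real.pi) + K.coeffNorm 0 * (4 * β ^ 2 / Real.pi ^ 2) with hLd
  set L2 : ℝ := 2 * Bd * Ld with hL2
  set Lc : ℝ := (4 + 7 * Real.sqrt 2) * Bd + K.coeffNorm 0 * Ld with hLc
  set BS : ℝ := |U| * (3 / 2) + U ^ 2 * max B 0 with hBS
  have hBd0 : 0 ≤ Bd := by positivity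
  have hLd0 : 0 ≤ Ld := by positivity
  have hBS0 : 0 ≤ BS := by positivity
  -- the bare cutoff-free carrier, its bound and its rate
  have hS0b : ∀ (L : ℕ) [NeZero L], L₀ ≤ L → ∀ (n : ℤ) (k : TorusSite 2 L),
      ‖(U : ℂ) * klOccInf L β U μ + (U : ℂ) ^ 2 * klSixInf L β U μ n k‖ ≤ BS := by
    intro L _ hL n k
    refine (norm_add_le _ _).trans (add_le_add ?_ ?_)
    · rw [norm_mul, Complex.norm_real, Real.norm_eq_abs]
      exact mul_le_mul_of_nonneg_left (norm_klOccInf_le β U μ) (abs_nonneg U)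
    · rw [norm_mul, norm_pow, Complex.norm_real, Real.norm_eq_abs, sq_abs]
      exact mul_le_mul_of_nonneg_left ((hsixB L hL n k).trans (le_max_left _ _)) (sq_nonneg U)
  have hS0r : ∀ (L : ℕ) [NeZero L], L₀ ≤ L → ∀ (L' : ℕ) [NeZero L'], L ≤ L' → ∀ (n : ℤ) (k : TorusSite 2 L) (k' : TorusSite 2 L'),
      ‖((U : ℂ) * klOccInf L β U μ + (U : ℂ) ^ 2 * klSixInf L β U μ n k) -
          ((U : ℂ) * klOccInf L' β U μ + (U : ℂ) ^ 2 * klSixInf L' β U μ n k')‖ ≤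
        (|U| * ρ₁ L + U ^ 2 * ρ₂ L) + U ^ 2 * D₂ * ∑ i, torusAbs (latticeMomentum L k i - latticeMomentum L' k' i) := by
    intro L _ hL L' _ hLL' n k k'
    have h1 := hocc L hL L' hLL'
    have h2 := hsix L hL L' hLL' n k k'
    have hU2 : ‖(U : ℂ) ^ 2‖ = U ^ 2 := by rw [norm_pow, Complex.norm_real, Real.norm_eq_abs, sq_abs]
    calc _ = ‖(U : ℂ) * (klOccInf L β U μ - klOccInf L' β U μ) + (U : ℂ) ^ 2 * (klSixInf L β U μ n k - klSixInf L' β U μ n k')‖ := by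
          congr 1; ring
      _ ≤ ‖(U : ℂ)‖ * ‖klOccInf L β U μ - klOccInf L' β U μ‖ + ‖(U : ℂ) ^ 2‖ * ‖klSixInf L β U μ n k - klSixInf L' β U μ n k'‖ := by
          refine (norm_add_le _ _).trans ?_; rw [norm_mul, norm_mul]
      _ ≤ |U| * ρ₁ L + U ^ 2 * (ρ₂ L + D₂ * ∑ i, torusAbs (latticeMomentum L k i - latticeMomentum L' k' i)) := by
          rw [Complex.norm_real, Real.norm_eq_abs, hU2]
          exact add_le_add (mul_le_mul_of_nonneg_left h1 (abs_nonneg U)) (mul_le_mul_of_nonneg_left h2 (sq_nonneg U))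
      _ = _ := by ring
  refine ⟨Bd ^ 2 * (U ^ 2 * D₂) + BS * L2 + Lc, fun L => Bd ^ 2 * (|U| * ρ₁ L + U ^ 2 * ρ₂ L), ?_, ?_⟩
  · have h := ((hρ₁.const_mul |U|).add (hρ₂.const_mul (U ^ 2))).const_mul (Bd ^ 2)
    simpa using h
  intro L _ hL L' _ hLL' n k k'
  have hL' : L₀ ≤ L' := hL.trans hLL'
  set q : Fin 2 → ℝ := latticeMomentum L k with hq
  set q' : Fin 2 → ℝ := latticeMomentum L' k' with hq'
  set x : ℝ := ∑ i, torusAbs (latticeMomentum L k i - latticeMomentum L' k' i) with hx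
  have hx0 : 0 ≤ x := Finset.sum_nonneg fun i _ => klvc_torusAbs_nonneg _
  set dq : ℂ := (1 : ℂ) - (K.eval q : ℂ) * ((bandCT μ 0 q : ℂ) - Complex.I * (fermiMatsubara β n : ℂ))⁻¹ with hdq
  set dq' : ℂ := (1 : ℂ) - (K.eval q' : ℂ) * ((bandCT μ 0 q' : ℂ) - Complex.I * (fermiMatsubara β n : ℂ))⁻¹ with hdq'
  set S : ℂ := (U : ℂ) * klOccInf L β U μ + (U : ℂ) ^ 2 * klSixInf L β U μ n k with hS
  set S' : ℂ := (U : ℂ) * klOccInf L' β U μ + (U : ℂ) ^ 2 * klSixInf L' β U μ n k' with hS'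
  have hE : klSelfEnergyInf L β U μ K n k = dq ^ 2 * S + (K.eval q : ℂ) * dq := klSelfEnergyInf_eq_bare_dressed hβ.ne' U μ K n k
  have hE' : klSelfEnergyInf L' β U μ K n k' = dq' ^ 2 * S' + (K.eval q' : ℂ) * dq' := klSelfEnergyInf_eq_bare_dressed hβ.ne' U μ K n k'
  -- the four inputs at this pair of volumes
  have h1 : ‖dq ^ 2‖ ≤ Bd ^ 2 := klso_dressSq_norm_le hβ μ K n q
  have h2 : ‖dq ^ 2 - dq' ^ 2‖ ≤ L2 * x := by
    have h := dressSq_sub_le_tmod hβ hK n q q'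
    have hxx : ∑ i, torusAbs (q i - q' i) = x := by rw [hx]
    rw [hxx] at h
    simpa only [hL2, hBd, hLd] using h
  have h3 : ‖(K.eval q : ℂ) * dq - (K.eval q' : ℂ) * dq'‖ ≤ Lc * x := by
    have h := eval_mul_dress_sub_le_tmod hβ hK n q q'
    have hxx : ∑ i, torusAbs (q i - q' i) = x := by rw [hx]
    rw [hxx] at h
    simpa only [hLc, hBd, hLd] using h
  have h4 : ‖S - S'‖ ≤ (|U| * ρ₁ L + U ^ 2 * ρ₂ L) + U ^ 2 * D₂ * x := hS0r L hL L' hLL' n k k'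
  have h5 : ‖S'‖ ≤ BS := hS0b L' hL' n k'
  have hρ0 : 0 ≤ |U| * ρ₁ L + U ^ 2 * ρ₂ L + U ^ 2 * D₂ * x := (norm_nonneg _).trans h4
  rw [hE, hE']
  calc ‖dq ^ 2 * S + (K.eval q : ℂ) * dq - (dq' ^ 2 * S' + (K.eval q' : ℂ) * dq')‖
      = ‖dq ^ 2 * (S - S') + (dq ^ 2 - dq' ^ 2) * S' + ((K.eval q : ℂ) * dq - (K.eval q' : ℂ) * dq')‖ := by congr 1; ring
    _ ≤ ‖dq ^ 2 * (S - S')‖ + ‖(dq ^ 2 - dq' ^ 2) * S'‖ + ‖(K.eval q : ℂ) * dq - (K.eval q' : ℂ) * dq'‖ := norm_add₃_le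
    _ = ‖dq ^ 2‖ * ‖S - S'‖ + ‖dq ^ 2 - dq' ^ 2‖ * ‖S'‖ + ‖(K.eval q : ℂ) * dq - (K.eval q' : ℂ) * dq'‖ := by
        rw [norm_mul, norm_mul]
    _ ≤ Bd ^ 2 * ((|U| * ρ₁ L + U ^ 2 * ρ₂ L) + U ^ 2 * D₂ * x) + (L2 * x) * BS + Lc * x := by
        gcongr
    _ = Bd ^ 2 * (|U| * ρ₁ L + U ^ 2 * ρ₂ L) + (Bd ^ 2 * (U ^ 2 * D₂) + BS * L2 + Lc) * x := by ring

/-! ## §4 The registered Cauchy stub from the bare cutoff-free rates -/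

/-- **`stub_vl_twoVolumeRate` FROM BARE, SPIN-FREE, CUTOFF-FREE VOLUME STATEMENTS.**  IF, for every datum of the registered stub, there are
`L₀ D₂ B ρ₁ ρ₂` with `ρ₁ → 0`, `ρ₂ → 0` and, beyond `L₀`: a rate of the density `‖klOccInf L β U μ − klOccInf L′ β U μ‖ ≤ ρ₁ L`, a
two-volume rate `‖klSixInf L β U μ n k − klSixInf L′ β U μ n k′‖ ≤ ρ₂ L + D₂·Σ_i |p_k i − p′_{k′} i|_𝕋` and a bound `‖klSixInf L β U μ n k‖ ≤ B`,
THEN the registered Cauchy stub of `KLRegimeVolumeLimitV12` holds verbatim (frame by `cutoffFreeRate_of_bareRates` with the stub's own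
`FrameOK`, cutoff by `twoVolumeRate_of_cutoffFreeRate`). -/
theorem stub_vl_twoVolumeRate_of_bareRates
    (hbare : ∀ (G : GeoConsts) (P : SplitConsts) (Q : EngConsts) (R : RenConsts), G.WF → P.WF → Q.WF → R.WF →
      ∃ c₅ : ℝ, 0 < c₅ ∧ ∀ c : ℝ, 0 < c → c ≤ c₅ → ∃ U₀ : ℝ, 0 < U₀ ∧
        ∀ μ ∈ klWindowC, ∀ U : ℝ, 0 < U → U ≤ U₀ → ∀ β : ℝ, klBetaMin ≤ β → β ≤ Real.exp (c / U ^ 2) →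
          ∀ K : TrigPolyC4v, klPredsV12.frameOK R U (nScales β) μ K →
            ∀ (Lstar : ℕ) (Mstar : ℕ → ℕ), TowerP klPredsV12 G P Q R β U μ K Lstar Mstar →
              ∃ L₀ : ℕ, ∃ D₂ : ℝ, ∃ B : ℝ, ∃ ρ₁ : ℕ → ℝ, ∃ ρ₂ : ℕ → ℝ, Tendsto ρ₁ atTop (𝓝 0) ∧ Tendsto ρ₂ atTop (𝓝 0) ∧
                (∀ (L : ℕ) [NeZero L], L₀ ≤ L → ∀ (L' : ℕ) [NeZero L'], L ≤ L' → ‖klOccInf L β U μ - klOccInf L' β U μ‖ ≤ ρ₁ L) ∧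
                (∀ (L : ℕ) [NeZero L], L₀ ≤ L → ∀ (L' : ℕ) [NeZero L'], L ≤ L' →
                  ∀ (n : ℤ) (k : TorusSite 2 L) (k' : TorusSite 2 L'),
                    ‖klSixInf L β U μ n k - klSixInf L' β U μ n k'‖ ≤
                      ρ₂ L + D₂ * ∑ i, torusAbs (latticeMomentum L k i - latticeMomentum L' k' i)) ∧
                (∀ (L : ℕ) [NeZero L], L₀ ≤ L → ∀ (n : ℤ) (k : TorusSite 2 L), ‖klSixInf L β U μ n k‖ ≤ B)) :
    ∀ (G : GeoConsts) (P : SplitConsts) (Q : EngConsts) (R : RenConsts), G.WF → P.WF → Q.WF → R.WF →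
      ∃ c₅ : ℝ, 0 < c₅ ∧ ∀ c : ℝ, 0 < c → c ≤ c₅ → ∃ U₀ : ℝ, 0 < U₀ ∧
        ∀ μ ∈ klWindowC, ∀ U : ℝ, 0 < U → U ≤ U₀ → ∀ β : ℝ, klBetaMin ≤ β → β ≤ Real.exp (c / U ^ 2) →
          ∀ K : TrigPolyC4v, klPredsV12.frameOK R U (nScales β) μ K →
            ∀ (Lstar : ℕ) (Mstar : ℕ → ℕ), TowerP klPredsV12 G P Q R β U μ K Lstar Mstar →
              ∃ L₀ : ℕ, ∃ Mth : ℕ → ℕ, ∃ D : ℝ, ∃ ρ : ℕ → ℝ, Tendsto ρ atTop (𝓝 0) ∧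
                ∀ (L : ℕ) [NeZero L], L₀ ≤ L → ∀ (M : ℕ) [NeZero M], Mth L ≤ M →
                  ∀ (L' : ℕ) [NeZero L'], L ≤ L' → ∀ (M' : ℕ) [NeZero M'], Mth L' ≤ M' →
                    ∀ (σ : Fin 2) (ω : MatsubaraIdx M) (ω' : MatsubaraIdx M'), matsubaraInt M ω = matsubaraInt M' ω' →
                      ∀ (k : TorusSite 2 L) (k' : TorusSite 2 L'),
                        ‖klSelfEnergy L M β U μ K klE0 (nScales β + 1) (ω, k) σ -
                            klSelfEnergy L' M' β U μ K klE0 (nScales β + 1) (ω', k') σ‖ ≤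
                          ρ L + D * ∑ i, torusAbs (latticeMomentum L k i - latticeMomentum L' k' i) := by
  refine stub_vl_twoVolumeRate_of_cutoffFreeRate fun G P Q R hG hP hQ hR => ?_
  obtain ⟨c₅, hc₅, hc⟩ := hbare G P Q R hG hP hQ hR
  refine ⟨c₅, hc₅, fun c hc0 hcc => ?_⟩
  obtain ⟨U₀, hU₀, hU⟩ := hc c hc0 hcc
  refine ⟨U₀, hU₀, fun μ hμ U hU0 hUU β hβmin hβmax K hK Lstar Mstar hT => ?_⟩
  have hβ : 0 < β := pos_of_klBetaMin_le hβmin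
  obtain ⟨L₀, D₂, B, ρ₁, ρ₂, hρ₁, hρ₂, hocc, hsix, hsixB⟩ := hU μ hμ U hU0 hUU β hβmin hβmax K hK Lstar Mstar hT
  have hK' : FrameOK R U (nScales β) μ K := hK
  obtain ⟨D, ρ, hρ, h⟩ := cutoffFreeRate_of_bareRates hβ hK' U hρ₁ hρ₂ hocc hsix hsixB
  exact ⟨L₀, D, ρ, hρ, h⟩

end Summit.HubbardSuperconductivity.HubbardSuperconductivity.Theorems.TwoPointAssembly

end
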